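import Literature.AnabelianGeometry.EtaleTheta.Discharge.Sec5Thm57HsurjOfConstantRoots
import Literature.AnabelianGeometry.EtaleTheta.Discharge.Sec5Thm57FinalKnitV3

/-!
# [EtTh] §5, Theorem 5.7 at the genuine connected tower — FINAL KNIT v3 with the Lemma 5.8 binder `hsurj` (GAP G-f123-1)
# REPLACED by the roots-of-constants law over `A_1` (pp. 329–331 / PDF pp. 103–105; Prop 4.2 p.316 / PDF p.90 L14–17)

Mochizuki, *The étale theta function …*, Publ. RIMS **45** (2009) [cite: MochizukiEtTh2009, Thm 5.7 p.330 (PDF p.104); Lem 5.8 p.331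
(PDF p.105); Prop 4.2 p.316 (PDF p.90); Def 4.1 (iii) p.313 (PDF p.87)].  abc-iut cell, layer L2, node `EtTh:Thm5.7`; seat abc-iut-f-123
gen 5 (row «`hsurj` = G-f123-1», this lineage's residual of record).  PROOF-ONLY (0 definitions, 0 new named facts; nothing landed is edited
or restated): ONE application of abc-iut-w6-d077's closer `ThetaFrobenioidTower.thetaRootPreservedAll_ofConnectedTemperoidYddFamily_final_v3`
(p458453) with its per-normalised-anchor binder `hsurj` («[EtTh] Lem. 5.8 at the discrepancy unit `u₁`, read on `B_N`» — GAP G-f123-1)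
SUPPLIED by `BiKummerSetting.hsurj_of_constantRootsAt_family` (p462665, `Discharge/Sec5Thm57HsurjOfConstantRoots.lean`) from the
roots-of-constants law `hL` OVER `A_1 := (R 1).AN` — abc-iut-w4-d044's binder of `Prop42Sub.unitRootsUpstairsAt_of_constantRootsAt`
(p457540; at `A_⊙` it is GAP G-w4d044-1 verbatim): «for Frobenius-trivial `(N, H_⊙^{bs-fld})`-saturated `A″` and `g : A″^bs → A_1^bs`, every
`Div_B`-trivial `ξ ∈ B(A_1^bs)` acquires an `N`-th root in `B(A″^bs)` along `g`» ([EtTh] Def 4.1 (iii)(a) + Prop 3.4 (ii) / [FrdII] Rmk 2.2.1,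
the source print invokes at Prop 4.2 (iv) p.90 L14–17 and, for the constant `u`, at Lemma 5.8 "`(K^×)^{1/N} ⊆ O^×(B_N^birat)`").
RESULT `thetaRootPreservedAll_ofConnectedTemperoidYddFamily_final_v3_of_constantRootsLaw`: the statement of `…_final_v3` VERBATIM except that
the binder `hsurj` is replaced by `hL`; all other binders ((A) junction data, `hF`, `hαover`, `hcharAN`, `hdivA`, `hP24`, the §4 package,
`hcfix`, `hivPiso`, (C) `hc`) unchanged and passed through.  WHY THIS IS A REDUCTION AND NOT A RE-LABELLING: `hL` over `A_1` is the input the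
`…_final_v4` knit needs ANYWAY for `hivPiso` (abc-iut-L2-t4 R480: «h₅-at-R′ ⟸ `unitRootsUpstairsAt_of_constantRootsAt` = G-w4d044-1 over `A_1`»;
cf. `NthRoot.l58_and_unitRootsUpstairsAt_of_constantRootsAt`, p462665: ONE binder, BOTH clauses) — so G-f123-1 drops out of the node's residual
as REDUNDANT given G-w4d044-1-over-`A_1`; and at the faithful [FrdII] Def 2.2 (ii) reading `hL` ⟸ Rmk 2.2.1 `SaturatedInvariantsAdmitRoots`
(a theorem at the arithmetic contexts, layer L1) + `hconst` (`Prop42Sub.constantRootsAt_of_def22Reading`).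
HONEST FRAMING: kernel-checked composition of landed theorems for data so parametrised (no instance of `TemperedFrobenioid T₀ (ConnectedPart
(BTemp X.Pi)) VD` for an actual curve is constructed here); the law `hL` is NOT discharged here; nothing asserts any result of [EtTh]
unconditionally; typed ≠ discharged — PROVED modulo the displayed binders; no side taken on anything downstream ([IUTchIII] Cor. 3.12 in particular).
-/

noncomputable section

namespace Literature.AnabelianGeometry.EtaleTheta

open CategoryTheory Opposite Literature.AlgebraicGeometry.Frobenioids Literature.AnabelianGeometry.SemiGraphs
  Literature.AnabelianGeometry.SemiGraphs.GaloisObjects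

universe v₀ u₁ v₁

namespace ThetaFrobenioidTower

section DictionaryOfConstantRoots

variable {K : Type} [Field K] {X : SemiGraphs.TemperedArithmeticGroup.{0} K} {D₀ : Type} [Category.{v₀} D₀]
  {V : FrdIMonoidStub.{0}} {T₀ : RealifiedDivisorMonoids (D₀ := D₀) V}
  {VD : FrdICatStub.{1, 0, 0} (ConnectedPart (BTemp X.Pi))}
  {tf : TemperedFrobenioid T₀ (ConnectedPart (BTemp X.Pi)) VD} {hZ : tf.monoidType = MonoidType.Z}
  {hP : ∀ A : (ConnectedPart (BTemp X.Pi))ᵒᵖ, IsPerfect (tf.Φ.carrier A)}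
  {NH : Subgroup (Field.absoluteGaloisGroup K) → tf.category → ℕ+ → Prop}
  {E : Set ℕ+} (𝒯 : ThetaEnvTower.{0} E) (ιX : 𝒯.PiX ≃ₜ* X.Pi)
  {pullFrac : ∀ {A A' : (BiKummerSetting.mkOfConnectedTemperoidYddTower X tf hZ hP NH 𝒯 ιX).C} (_ : A' ⟶ A),
    (BiKummerSetting.mkOfConnectedTemperoidYddTower X tf hZ hP NH 𝒯 ιX).biratUnits A →
      (BiKummerSetting.mkOfConnectedTemperoidYddTower X tf hZ hP NH 𝒯 ιX).biratUnits A'}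
  {lv : ℕ+}
  {θ : (BiKummerSetting.mkOfConnectedTemperoidYddTower X tf hZ hP NH 𝒯 ιX).biratUnits
    (BiKummerSetting.mkOfConnectedTemperoidYddTower X tf hZ hP NH 𝒯 ιX).Aodot}
  {Bl : (BiKummerSetting.mkOfConnectedTemperoidYddTower X tf hZ hP NH 𝒯 ιX).C}
  {Pl : (BiKummerSetting.mkOfConnectedTemperoidYddTower X tf hZ hP NH 𝒯 ιX).FractionPair θ Bl}
  {Rl : (BiKummerSetting.mkOfConnectedTemperoidYddTower X tf hZ hP NH 𝒯 ιX).NthRoot θ Pl lv pullFrac}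
  (h : ModelFrobenioid.Hypotheses tf.divisorMonoid tf.ratFnFunctor)
  (Q : FrobenioidTheta.ThetaSubquotientStub.{0} (ConnectedPart (BTemp X.Pi))) (odd_l : Odd (lv : ℕ))
  (R : ∀ N : ℕ+, (BiKummerSetting.mkOfConnectedTemperoidYddTower X tf hZ hP NH 𝒯 ιX).NthRoot Rl.root Rl.pair N pullFrac)
  (K' : Type) [Field K'] {X₀ : ConnectedPart (BTemp X.Pi)}
  (hX₀ : ∀ Y : ConnectedPart (BTemp X.Pi), Subsingleton (Y ⟶ X₀)) (t : ∀ N : ℕ+, (R N).BN.base ⟶ X₀)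
  (c₀ : K'ˣ →* (tf.ratFnFunctor.obj (op X₀))ˣ)
  (hc₀ : Function.Injective c₀) (ht : ∀ N : ℕ+, Function.Injective (tf.ratFnFunctor.map (t N).op).hom)
  (hinvc : ∀ (N : ℕ+) (g : Aut (R N).AN.base),
    pull tf.divisorMonoid g.hom (ModelFrobenioid.div (R N).pair.num) = ModelFrobenioid.div (R N).pair.num)
  (hinvp : ∀ (N : ℕ+) (y : 𝒯.PiX), y ∈ 𝒯.PiYdd →
    pull tf.divisorMonoid ((BiKummerSetting.mkOfConnectedTemperoidYddTower X tf hZ hP NH 𝒯 ιX).galoisSurj (R N).AN.base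
      (R N).αData.isGalois (ιX y)).hom (ModelFrobenioid.div (R N).pair.den) = ModelFrobenioid.div (R N).pair.den)
  (α : ∀ {N N' : ℕ+}, (N : ℕ) ∣ N' → ((R N').AN ⟶ (R N).AN))
  (β : ∀ {N N' : ℕ+}, (N : ℕ) ∣ N' → ((R N').BN ⟶ (R N).BN))
  (comm_sCap : ∀ {N N' : ℕ+} (hd : (N : ℕ) ∣ N'), (R N').pair.num ≫ β hd = α hd ≫ (R N).pair.num)
  (comm_sCup : ∀ {N N' : ℕ+} (hd : (N : ℕ) ∣ N'), (R N').pair.den ≫ β hd = α hd ≫ (R N).pair.den)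
  (isIsometry_α : ∀ {N N' : ℕ+} (hd : (N : ℕ) ∣ N'),
    ((BiKummerSetting.mkOfConnectedTemperoidYddTower X tf hZ hP NH 𝒯 ιX).sec5Stub h).pre.IsIsometry (α hd))
  (degFr_α : ∀ {N N' : ℕ+} (hd : (N : ℕ) ∣ N'),
    (((BiKummerSetting.mkOfConnectedTemperoidYddTower X tf hZ hP NH 𝒯 ιX).sec5Stub h).pre.degFr (α hd) : ℕ) * N = N')
  (isIsometry_β : ∀ {N N' : ℕ+} (hd : (N : ℕ) ∣ N'),
    ((BiKummerSetting.mkOfConnectedTemperoidYddTower X tf hZ hP NH 𝒯 ιX).sec5Stub h).pre.IsIsometry (β hd))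
  (degFr_β : ∀ {N N' : ℕ+} (hd : (N : ℕ) ∣ N'),
    (((BiKummerSetting.mkOfConnectedTemperoidYddTower X tf hZ hP NH 𝒯 ιX).sec5Stub h).pre.degFr (β hd) : ℕ) * N = N')
  (baseFrob_α : ∀ {N N' : ℕ+} (hd : (N : ℕ) ∣ N'),
    (BiKummerSetting.mkOfConnectedTemperoidYddTower X tf hZ hP NH 𝒯 ιX).IsOfBaseFrobeniusType (α hd))
  -- the §1 Setting against which the constants of `B_1` are read (abc-iut-L2-t8's model `Cu.thetaEnvData μ₁ hC hS`)
  {p : ℕ} [Fact p.Prime] {DS : ThetaSetting p} {ES : DS.EtaleThetaData} {l' : ℕ} (Cu : ES.DoubleUnderline l')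
  (hC : DS.Compat) (hS : DS.Sec2Hyps)
  (h44 : BiKummerSetting.Thm44Hyp (BiKummerSetting.mkOfConnectedTemperoidYddTower X tf hZ hP NH 𝒯 ιX)
    (BiKummerSetting.mkOfConnectedTemperoidYddTower X tf hZ hP NH 𝒯 ιX))
  (ψ : ∀ A : (BiKummerSetting.mkOfConnectedTemperoidYddTower X tf hZ hP NH 𝒯 ιX).C,
    (BiKummerSetting.mkOfConnectedTemperoidYddTower X tf hZ hP NH 𝒯 ιX).biratUnits A ≃*
      (BiKummerSetting.mkOfConnectedTemperoidYddTower X tf hZ hP NH 𝒯 ιX).biratUnits (h44.Ψ.functor.obj A))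
  (hpull : ∀ {A A' : (BiKummerSetting.mkOfConnectedTemperoidYddTower X tf hZ hP NH 𝒯 ιX).C} (φ : A' ⟶ A)
    (f : (BiKummerSetting.mkOfConnectedTemperoidYddTower X tf hZ hP NH 𝒯 ιX).biratUnits A),
      ψ A' (pullFrac φ f) = pullFrac (h44.Ψ.functor.map φ) (ψ A f))
  (hii : BiKummerSetting.Thm44_ii h44 ψ) (h3 : h44.PreservesFrobeniusStructure) (h4b : h44.PreservesBaseFrobeniusTypeData)
  (h8 : h44.PreservesAmple) (h15a : h44.PreservesFixedByHA ψ) (h15 : h44.PreservesSaturated ψ)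
  -- (B1)/(B1′): the Def. 4.1 (iv) datum of each transition `α_{1,N}` and its pull-back compatibility
  (D : ∀ N : ℕ+, (BiKummerSetting.mkOfConnectedTemperoidYddTower X tf hZ hP NH 𝒯 ιX).BaseFrobeniusTypeData (α (one_dvd_level N)))

include hX₀ h hc₀ ht comm_sCap comm_sCup isIsometry_α degFr_α isIsometry_β degFr_β hpull hii h3 h4b h8 h15a h15 in
/-- **[EtTh] Theorem 5.7 at the genuine connected tower — FINAL KNIT v3 with `hsurj` ⟸ the roots-of-constants law over `A_1`**: the
closer `…_final_v3` (abc-iut-w6-d077, p458453) with its Lemma 5.8 binder `hsurj` (GAP G-f123-1) REPLACED by `hL` — abc-iut-w4-d044's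
roots-of-constants law over `A_1 = (R 1).AN` (the same binder that supplies Prop 4.2 (iv)'s `h₅`), discharged through
`BiKummerSetting.hsurj_of_constantRootsAt_family` (p462665); every other binder verbatim.
[cite: MochizukiEtTh2009, Thm 5.7 p.329–330 (PDF pp.103–104); Lem 5.8 p.331 (PDF p.105); Prop 4.2 p.316 (PDF p.90)] -/
theorem thetaRootPreservedAll_ofConnectedTemperoidYddFamily_final_v3_of_constantRootsLaw
    (T : ThetaFrobenioidTower.{0} (BiKummerSetting.mkOfConnectedTemperoidYddTower X tf hZ hP NH 𝒯 ιX).C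
      (ConnectedPart (BTemp X.Pi)))
    (hT : T = ofConnectedTemperoidFamily h Q odd_l R ιX K' (fun N => (Units.map (tf.ratFnFunctor.map (t N).op).hom).comp c₀)
      (fun N => tf.unitsMap_comp_injective (t N) hc₀ (ht N)) hinvc hinvp α β comm_sCap comm_sCup isIsometry_α degFr_α
      isIsometry_β degFr_β baseFrob_α)
    (hnd : IsNonDilatingOn tf.divisorMonoid)
    -- (A) `hgc₁` RE-KEYED (abc-iut-w5-d123 p447915): the ONE `ConstantsDictionary` junction binder at the first root + `hY₁`
    {μ₁ : DS.CyclotomeMod l' (T.atLevel 1).N} {ι₁ : (T.atLevel 1).PiX ≃ₜ* (Cu.thetaEnvData μ₁ hC hS).PiX}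
    {m₁ : (T.atLevel 1).muTorsion (T.atLevel 1).BN (T.atLevel 1).N ≃* (Cu.thetaEnvData μ₁ hC hS).mu}
    (act₁ : (T.atLevel 1).BiratAutAction) {Cst₁ : Subgroup ((T.atLevel 1).biratUnits (T.atLevel 1).BN)}
    {ν₁ : Cst₁ →* (PadicAlgCl p)ˣ}
    (hD₁ : ThetaFrobenioid.BiratAutAction.ConstantsDictionary act₁ Cu μ₁ hC hS ι₁ m₁ Cst₁ ν₁)
    (hY₁ : (T.atLevel 1).IdentifiesPiY (Cu.thetaEnvData μ₁ hC hS) ι₁.toMulEquiv)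
    -- (A) `hfac₁` RE-KEYED (abc-iut-w5-d123 p447915): Prop. 3.4 (ii), the identification `D → D₀ → D^cnst ≅ aug_* ⋙ G`, and `hYdd`
    {Dcnst : Type u₁} [Category.{v₁} Dcnst] (cnst : D₀ ⥤ Dcnst) (G : ConnectedPart (BTemp (Field.absoluteGaloisGroup K)) ⥤ Dcnst)
    (ecn : tf.base ⋙ cnst ≅ QuasiTemperoid.pushforward X.aug.toMonoidHom X.aug_surjective X.augIsOpenMap_holds ⋙ G)
    (hP34 : RealifiedDivisorMonoids.Prop34Cnst T₀ cnst)
    (hYdd : ∀ y : 𝒯.PiX, ∃ k ∈ 𝒯.PiYdd, X.aug (ιX k) = X.aug (ιX y))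
    -- the rendering law of `pullFrac` (the model's `((·)^birat)^*`), the transitions over the base pair, and the Prop. 2.4-class
    -- clause at the chosen first root ("`S₂^bs` characteristic", p.329): these DISCHARGE `hpull₂`, `hD`, `hf`, `hΨFT`, `hbs` of `…_final`
    (hF : ∀ {B B' : (BiKummerSetting.mkOfConnectedTemperoidYddTower X tf hZ hP NH 𝒯 ιX).C} (φ : B' ⟶ B)
      (y : (BiKummerSetting.mkOfConnectedTemperoidYddTower X tf hZ hP NH 𝒯 ιX).biratUnits B), pullFrac φ y = tf.pullFracModel φ y)
    (hαover : ∀ N : ℕ+, α (one_dvd_level N) ≫ (R 1).α = (R N).α)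
    -- «`A_N^bs` characteristic» at EVERY level (the [EtTh] Prop. 2.4-class clause; its `N = 1` instance is v2's `hcharN`; it yields v2's `hebs`)
    (hcharAN : ∀ N : ℕ+, IsTopCharacteristic X.Pi (galoisSurjOf X.isTempered (R N).AN.base.obj (R N).αData.isGalois).ker)
    (hdivA : ∀ αA : h44.Ψ.functor.obj (T.AN 1) ≅ T.AN 1, ∃ ε : Aut (T.AN 1),
      T.pre.div (αA.inv ≫ h44.Ψ.functor.map (T.sCap 1)) = T.pre.div (ε.hom ≫ T.sCap 1) ∧
      T.pre.div (αA.inv ≫ h44.Ψ.functor.map (T.sCup 1)) = T.pre.div (ε.hom ≫ T.sCup 1))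
    (hP24 : ∀ γ : 𝒯.PiX ≃ₜ* 𝒯.PiX, 𝒯.PiYdd.map γ.toMulEquiv.toMonoidHom = 𝒯.PiYdd)
    -- per NORMALISED ANCHOR `(α₁, β₁, u₁)` and level, POINTWISE (abc-iut-f-123 p455663): (L58) Lemma 5.8 AT the discrepancy unit
    -- `u₁` read on `B_N`, and (CFix) the `H_{A_N}`-invariance of its function pulled back to `A_N`
    -- the roots-of-constants law OVER `A_1` ([EtTh] Def 4.1 (iii)(a) + Prop 3.4 (ii) / [FrdII] Rmk 2.2.1; abc-iut-w4-d044's `hL`,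
    -- G-w4d044-1's shape at `A_1`): it REPLACES v3's `hsurj` (GAP G-f123-1) via `BiKummerSetting.hsurj_of_constantRootsAt_family`
    (hL : ∀ (A'' : (BiKummerSetting.mkOfConnectedTemperoidYddTower X tf hZ hP NH 𝒯 ιX).C) (N : ℕ+)
      (g : A''.base ⟶ (R 1).AN.base) (ξ : tf.ratFnFunctor.obj (op (R 1).AN.base)),
      (BiKummerSetting.mkOfConnectedTemperoidYddTower X tf hZ hP NH 𝒯 ιX).IsFrobeniusTrivial A'' →
      (BiKummerSetting.mkOfConnectedTemperoidYddTower X tf hZ hP NH 𝒯 ιX).IsNHSaturatedBsFld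
        (BiKummerSetting.mkOfConnectedTemperoidYddTower X tf hZ hP NH 𝒯 ιX).HodotBsFld A'' N →
      divB tf.divisorMonoid tf.ratFnFunctor tf.divBNatTrans (op (R 1).AN.base) ξ = 1 →
        ∃ ζ : tf.ratFnFunctor.obj (op A''.base), ζ ^ (N : ℕ) = pull tf.ratFnFunctor g ξ)
    (hcfix : ∀ (α₁ : h44.Ψ.functor.obj (R 1).AN ≅ (R 1).AN) (β₁ : h44.Ψ.functor.obj (R 1).BN ≅ (R 1).BN) (u₁ : Aut (R 1).BN)
      (_ : u₁ ∈ (BiKummerSetting.mkOfConnectedTemperoidYddTower X tf hZ hP NH 𝒯 ιX).units (R 1).BN),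
      α₁.inv ≫ h44.Ψ.functor.map (R 1).pair.num ≫ β₁.hom = (R 1).pair.num →
      α₁.inv ≫ h44.Ψ.functor.map (R 1).pair.den ≫ β₁.hom = (R 1).pair.den ≫ u₁.hom →
      ∀ (N : ℕ+), (BiKummerSetting.mkOfConnectedTemperoidYddTower X tf hZ hP NH 𝒯 ιX).IsFixedByHA (R N).AN (R N).isSaturated.isAmple.isGalois
        (pullFrac (D N).α₁ (pullFrac (R 1).pair.den
          (tf.isUnit_ratFnFunctor T₀.isUnit_BΛ (R 1).BN (ModelFrobenioid.unit u₁.hom)).unit)))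
    -- Prop. 4.2 (iv) at the `u₁`-twisted level-1 pair, per NORMALISED ANCHOR, ACROSS an isomorphism of pairs ((r4); abc-iut-L2-t4 R480)
    (hivPiso : ∀ (α₁ : h44.Ψ.functor.obj (R 1).AN ≅ (R 1).AN) (β₁ : h44.Ψ.functor.obj (R 1).BN ≅ (R 1).BN) (u₁ : Aut (R 1).BN)
      (hu₁ : u₁ ∈ (BiKummerSetting.mkOfConnectedTemperoidYddTower X tf hZ hP NH 𝒯 ιX).units (R 1).BN),
      α₁.inv ≫ h44.Ψ.functor.map (R 1).pair.num ≫ β₁.hom = (R 1).pair.num →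
      α₁.inv ≫ h44.Ψ.functor.map (R 1).pair.den ≫ β₁.hom = (R 1).pair.den ≫ u₁.hom →
      ∀ (N : ℕ+) {A₂ B₂ : (BiKummerSetting.mkOfConnectedTemperoidYddTower X tf hZ hP NH 𝒯 ιX).C}
      {f₂ : (BiKummerSetting.mkOfConnectedTemperoidYddTower X tf hZ hP NH 𝒯 ιX).biratUnits A₂}
      {P₂ : (BiKummerSetting.mkOfConnectedTemperoidYddTower X tf hZ hP NH 𝒯 ιX).FractionPair f₂ B₂}
      (R' : (BiKummerSetting.mkOfConnectedTemperoidYddTower X tf hZ hP NH 𝒯 ιX).NthRoot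
        ((BiKummerSetting.mkOfConnectedTemperoidYddTower X tf hZ hP NH 𝒯 ιX).fracOf (R 1).pair.num ((R 1).pair.den ≫ u₁.hom)
          (R 1).pair.isPreStep_num
          ((BiKummerSetting.mkOfConnectedTemperoidYddTower X tf hZ hP NH 𝒯 ιX).isPreStep_comp_aut (R 1).pair.isPreStep_den u₁)
          ((BiKummerSetting.mkOfConnectedTemperoidYddTower X tf hZ hP NH 𝒯 ιX).baseEquivalent_comp_unit (R 1).pair.base_eq hu₁))
        ((R 1).pair.twistUnit u₁ hu₁ rfl
          (BiKummerSetting.disjointSupports_twistUnit h.isDivisorial (R 1).pair u₁)) N pullFrac)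
      (R₂ : (BiKummerSetting.mkOfConnectedTemperoidYddTower X tf hZ hP NH 𝒯 ιX).NthRoot f₂ P₂ N pullFrac)
      (eA : A₂ ≅ (R 1).AN) (eB : B₂ ≅ (R 1).BN),
      eA.inv ≫ P₂.num ≫ eB.hom = (R 1).pair.num → eA.inv ≫ P₂.den ≫ eB.hom = (R 1).pair.den ≫ u₁.hom →
      pullFrac eA.hom
          ((BiKummerSetting.mkOfConnectedTemperoidYddTower X tf hZ hP NH 𝒯 ιX).fracOf (R 1).pair.num ((R 1).pair.den ≫ u₁.hom)
            (R 1).pair.isPreStep_num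
            ((BiKummerSetting.mkOfConnectedTemperoidYddTower X tf hZ hP NH 𝒯 ιX).isPreStep_comp_aut (R 1).pair.isPreStep_den u₁)
            ((BiKummerSetting.mkOfConnectedTemperoidYddTower X tf hZ hP NH 𝒯 ιX).baseEquivalent_comp_unit (R 1).pair.base_eq hu₁)) = f₂ →
      ∀ (ebs : (BiKummerSetting.mkOfConnectedTemperoidYddTower X tf hZ hP NH 𝒯 ιX).base.obj R'.AN ≅
        (BiKummerSetting.mkOfConnectedTemperoidYddTower X tf hZ hP NH 𝒯 ιX).base.obj R₂.AN),
      (BiKummerSetting.mkOfConnectedTemperoidYddTower X tf hZ hP NH 𝒯 ιX).base.map R'.α =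
        ebs.hom ≫ (BiKummerSetting.mkOfConnectedTemperoidYddTower X tf hZ hP NH 𝒯 ιX).base.map (R₂.α ≫ eA.hom) →
        ∃ (v : (BiKummerSetting.mkOfConnectedTemperoidYddTower X tf hZ hP NH 𝒯 ιX).mu R'.BN N) (ζA : R'.AN ≅ R₂.AN)
          (ζB : R'.BN ≅ R₂.BN),
          ζA.hom ≫ R₂.pair.num = R'.pair.num ≫ ζB.hom ∧
          ζA.hom ≫ R₂.pair.den = (R'.pair.den ≫ (v : Aut R'.BN).hom) ≫ ζB.hom ∧
          ζA.hom ≫ R₂.α ≫ eA.hom = R'.α ∧ ζB.hom ≫ R₂.β ≫ eB.hom = R'.β ∧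
          (BiKummerSetting.mkOfConnectedTemperoidYddTower X tf hZ hP NH 𝒯 ιX).base.mapIso ζA = ebs)
    -- (C): the level-1 discrepancy constant of every normalised transport is a `2l`-th root of unity
    (hc : ∀ (α₁ : h44.Ψ.functor.obj (T.AN 1) ≅ T.AN 1) (β₁ : h44.Ψ.functor.obj (T.BN 1) ≅ T.BN 1) (u₁ : Aut (T.BN 1))
      (hu₁ : u₁ ∈ (T.atLevel 1).units (T.BN 1)),
      α₁.inv ≫ h44.Ψ.functor.map (T.sCap 1) ≫ β₁.hom = T.sCap 1 →
      α₁.inv ≫ h44.Ψ.functor.map (T.sCup 1) ≫ β₁.hom = T.sCup 1 ≫ u₁.hom →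
        ∀ c : T.Kˣ, (T.atLevel 1).unitsToBirat (T.BN 1) ⟨u₁, hu₁⟩ = T.constEmb 1 c → c ^ (2 * T.l) = 1) :
    T.ThetaRootPreservedAll h44.Ψ :=
  thetaRootPreservedAll_ofConnectedTemperoidYddFamily_final_v3 𝒯 ιX h Q odd_l R K' hX₀ t c₀ hc₀ ht hinvc hinvp α β comm_sCap
    comm_sCup isIsometry_α degFr_α isIsometry_β degFr_β baseFrob_α Cu hC hS h44 ψ hpull hii h3 h4b h8 h15a h15 D T hT hnd act₁ hD₁
    hY₁ cnst G ecn hP34 hYdd hF hαover hcharAN hdivA hP24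
    (fun _ _ u₁ hu₁ _ _ N =>
      (BiKummerSetting.mkOfConnectedTemperoidYddTower X tf hZ hP NH 𝒯 ιX).hsurj_of_constantRootsAt_family h R
        (fun N => α (one_dvd_level N)) (fun N => β (one_dvd_level N)) (fun N => comm_sCup (one_dvd_level N)) hL u₁ hu₁ N)
    hcfix hivPiso hc

end DictionaryOfConstantRoots

end ThetaFrobenioidTower

end Literature.AnabelianGeometry.EtaleTheta

end
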